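import Mathlib
import HarnessLib

/-!
# Crux `EulerZoomLiouville.PowerGaugeEulerLiouville` (stmt-NavierStokesRegularity-19832), width sub-line `casimir_haul` (ns-idea-11, REV3),
# stub H4c `stub_haulBook` — part (a): THE BOOKKEEPING ALGEBRA (pure real inequalities)

Seat ns-sfl-p1 g10 (`--supports stmt-NavierStokesRegularity-19832 --as helper`).  Port BY NAME of the H4c toolkit of
`Cruxes/PowerGaugeEulerLiouville/Lines/casimir_haul.lean` REV3 (sha16 31279a74fac8e2c7; proofs by ns-idea-11 g11, in-file, sorry-free), §«Elementary real
inequalities» and §«The bookkeeping constants», VERBATIM: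

* `moment_log_bound` — `M·L(M) ≤ (2 + 4 log b)·(m + b⁻²)` for `0 ≤ M ≤ m`, `b ≥ 1` (the `M log(1/M)` hump is absorbed by the `b⁻²` padding);
* `sqrt_mul_sqrt_le_amgm` (`√x√y ≤ (θx + y/θ)/2`), `le_young` (`t ≤ θ/2 + t²/(2θ)`), `amgm_balanced` (`θ = √(X/W)` ⇒ `θy + z/θ ≤ 2√(WX)`);
* `rpow_3b_le` — `(3b)^e ≤ 3 b^{1−ρ₁}` for `b ≥ 1`, `0 ≤ ρ₁`, `e ≤ 1 − ρ₁`;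
* ★ `book_algebra` — THE BOOKKEEPING ALGEBRA of H4c: a choice of the three AM–GM parameters making the integrated majorant
  `≤ K (c+1) b^{1−ρ₁/2}/λ` with `K = 13 C √(2 + 4/ρ₁) + 13 (C+1)`, `ρ₁ = min ρ 1` (`log b ≤ b^{ρ₁}/ρ₁`).
Parts (b) `…CasimirHaulBookSlices` (per-slice majorant) and (c) `…CasimirHaulBook` (★ `CasimirHaul.haulBook` = `Sig.stub_haulBook` δ-unfolded) follow.

HONEST FRAMING: real algebra for a width sub-line of the crux class; nothing here bears on the crux E (19832 OPEN) or on NS regularity; not E. [folklore]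
-/

noncomputable section

-- flat `Theorems/<Route><Decl>…` files of one crux share the namespace of the crux (tree convention)
set_option linter.dupNamespace false

open MeasureTheory Set Filter Topology Metric Function
open scoped NNReal ENNReal

namespace Summit.NavierStokesRegularity.NavierStokesRegularity.Theorems.PowerGaugeEulerLiouville.CasimirHaul

/-- `M·L(M) ≤ (2 + 4 log b)·(m + b⁻²)` for `0 ≤ M ≤ m`, `b ≥ 1` (the `M log(1/M)` hump is absorbed by the `b⁻²` padding). (ns-idea-11 g11, ported.) [folklore] -/
theorem moment_log_bound {b M m : ℝ} (hb : 1 ≤ b) (hM : 0 ≤ M) (hMm : M ≤ m) :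
    M * (1 + Real.log b + max 0 (Real.log (b / M))) ≤ (2 + 4 * Real.log b) * (m + 1 / b ^ 2) := by
  have hb0 : 0 < b := by linarith
  have hlogb : 0 ≤ Real.log b := Real.log_nonneg hb
  have hm : 0 ≤ m := hM.trans hMm
  have hb2 : 0 < 1 / b ^ 2 := by positivity
  rcases hM.eq_or_lt with hM0 | hMpos
  · rw [← hM0]; simp only [zero_mul]; positivity
  by_cases hcase : 1 / b ^ 2 ≤ M
  · -- `b/M ≤ b³`, so `log⁺(b/M) ≤ 3 log b`
    have h1 : max 0 (Real.log (b / M)) ≤ 3 * Real.log b := by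
      refine max_le (by positivity) ?_
      have hbM : b / M ≤ b ^ 3 := by
        rw [div_le_iff₀ hMpos]
        have : b ^ 3 * (1 / b ^ 2) = b := by field_simp
        nlinarith [this, pow_pos hb0 3]
      calc Real.log (b / M) ≤ Real.log (b ^ 3) := Real.log_le_log (by positivity) hbM
        _ = 3 * Real.log b := by rw [Real.log_pow]; norm_num
    calc M * (1 + Real.log b + max 0 (Real.log (b / M))) ≤ M * (1 + 4 * Real.log b) := by
          apply mul_le_mul_of_nonneg_left _ hM; linarith
      _ ≤ m * (1 + 4 * Real.log b) := by apply mul_le_mul_of_nonneg_right hMm; positivity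
      _ ≤ (2 + 4 * Real.log b) * (m + 1 / b ^ 2) := by nlinarith
  · rw [not_le] at hcase
    -- `M < b⁻² ≤ 1`: `log(b/M) = log b + log(1/M) ≥ 0` and `M log(1/M) ≤ b⁻²(1 + log b²)`
    have hM1 : M ≤ 1 := by
      have : 1 / b ^ 2 ≤ 1 := by rw [div_le_one (by positivity)]; nlinarith
      linarith
    have hlogM : 0 ≤ Real.log (1 / M) := Real.log_nonneg (by rw [le_div_iff₀ hMpos]; linarith)
    have hsplit : Real.log (b / M) = Real.log b + Real.log (1 / M) := by
      rw [← Real.log_mul hb0.ne' (by positivity)]; congr 1; field_simp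
    have hmax : max 0 (Real.log (b / M)) = Real.log b + Real.log (1 / M) := by
      rw [hsplit]; exact max_eq_right (by positivity)
    rw [hmax]
    -- `M log(1/M) ≤ b⁻² + b⁻² log(b²)` via `log x ≤ x - 1`
    have hB : M ≤ 1 / b ^ 2 := hcase.le
    have hkey : M * Real.log (1 / M) ≤ 1 / b ^ 2 + 1 / b ^ 2 * Real.log (b ^ 2) := by
      have h1 : Real.log (1 / M) = Real.log ((1 / b ^ 2) / M) + Real.log (b ^ 2) := by
        rw [← Real.log_mul (by positivity) (by positivity)]; congr 1; field_simp
      rw [h1, mul_add]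
      have h2 : M * Real.log ((1 / b ^ 2) / M) ≤ 1 / b ^ 2 := by
        have h3 : Real.log ((1 / b ^ 2) / M) ≤ (1 / b ^ 2) / M - 1 := Real.log_le_sub_one_of_pos (by positivity)
        calc M * Real.log ((1 / b ^ 2) / M) ≤ M * ((1 / b ^ 2) / M - 1) := mul_le_mul_of_nonneg_left h3 hM
          _ = 1 / b ^ 2 - M := by field_simp
          _ ≤ 1 / b ^ 2 := by linarith
      have h4 : M * Real.log (b ^ 2) ≤ 1 / b ^ 2 * Real.log (b ^ 2) :=
        mul_le_mul_of_nonneg_right hB (Real.log_nonneg (by nlinarith))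
      linarith
    have hlogb2 : Real.log (b ^ 2) = 2 * Real.log b := by rw [Real.log_pow]; norm_num
    rw [hlogb2] at hkey
    have h5 : M * (1 + Real.log b + Real.log b) ≤ 1 / b ^ 2 * (1 + 2 * Real.log b) := by
      calc M * (1 + Real.log b + Real.log b) ≤ 1 / b ^ 2 * (1 + Real.log b + Real.log b) :=
            mul_le_mul_of_nonneg_right hB (by positivity)
        _ = 1 / b ^ 2 * (1 + 2 * Real.log b) := by ring
    calc M * (1 + Real.log b + (Real.log b + Real.log (1 / M)))
        = M * (1 + Real.log b + Real.log b) + M * Real.log (1 / M) := by ring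
      _ ≤ 1 / b ^ 2 * (1 + 2 * Real.log b) + (1 / b ^ 2 + 1 / b ^ 2 * (2 * Real.log b)) := add_le_add h5 hkey
      _ = 1 / b ^ 2 * (2 + 4 * Real.log b) := by ring
      _ ≤ (2 + 4 * Real.log b) * (m + 1 / b ^ 2) := by nlinarith

/-- AM–GM with square roots: `√x·√y ≤ (θ x + y/θ)/2`. (ns-idea-11 g11, ported.) [folklore] -/
theorem sqrt_mul_sqrt_le_amgm {x y θ : ℝ} (hx : 0 ≤ x) (hy : 0 ≤ y) (hθ : 0 < θ) :
    Real.sqrt x * Real.sqrt y ≤ (θ * x + y / θ) / 2 := by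
  have hsx := Real.sq_sqrt hx
  have hsy := Real.sq_sqrt hy
  have h0 : 0 ≤ (θ * Real.sqrt x - Real.sqrt y) ^ 2 := sq_nonneg _
  rw [le_div_iff₀ (by norm_num : (0 : ℝ) < 2)]
  have h1 : Real.sqrt x * Real.sqrt y * 2 * θ ≤ (θ * x + y / θ) * θ := by
    have : (θ * x + y / θ) * θ = θ ^ 2 * x + y := by field_simp
    rw [this]
    nlinarith [Real.sqrt_nonneg x, Real.sqrt_nonneg y]
  exact le_of_mul_le_mul_right h1 hθ

/-- Young: `t ≤ θ/2 + t²/(2θ)`. (ns-idea-11 g11, ported.) [folklore] -/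
theorem le_young {t θ : ℝ} (hθ : 0 < θ) : t ≤ θ / 2 + t ^ 2 / (2 * θ) := by
  have h0 : 0 ≤ (t - θ) ^ 2 := sq_nonneg _
  have h1 : t * (2 * θ) ≤ (θ / 2 + t ^ 2 / (2 * θ)) * (2 * θ) := by
    have : (θ / 2 + t ^ 2 / (2 * θ)) * (2 * θ) = θ ^ 2 + t ^ 2 := by field_simp
    rw [this]; nlinarith
  exact le_of_mul_le_mul_right h1 (by positivity)

/-- The balanced AM–GM value: with `θ = √(X/W)`, `θ y + z/θ ≤ 2√(W X)` whenever `0 ≤ y ≤ W`, `0 ≤ z ≤ X`. (ns-idea-11 g11, ported.) [folklore] -/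
theorem amgm_balanced {W X y z : ℝ} (hW : 0 < W) (hX : 0 < X) (hyW : y ≤ W) (hzX : z ≤ X) :
    Real.sqrt (X / W) * y + z / Real.sqrt (X / W) ≤ 2 * Real.sqrt (W * X) := by
  have hθ : 0 < Real.sqrt (X / W) := Real.sqrt_pos.2 (by positivity)
  have hθW : Real.sqrt (X / W) * W = Real.sqrt (W * X) := by
    rw [show W * X = (X / W) * W ^ 2 by field_simp, Real.sqrt_mul (by positivity), Real.sqrt_sq hW.le]
  have hXθ : X / Real.sqrt (X / W) = Real.sqrt (W * X) := by
    rw [div_eq_iff hθ.ne', ← hθW]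
    have : Real.sqrt (X / W) * Real.sqrt (X / W) = X / W := Real.mul_self_sqrt (by positivity)
    calc X = X / W * W := by field_simp
      _ = Real.sqrt (X / W) * Real.sqrt (X / W) * W := by rw [this]
      _ = Real.sqrt (X / W) * W * Real.sqrt (X / W) := by ring
  have h1 : Real.sqrt (X / W) * y ≤ Real.sqrt (W * X) := by
    rw [← hθW]; exact mul_le_mul_of_nonneg_left hyW hθ.le
  have h2 : z / Real.sqrt (X / W) ≤ Real.sqrt (W * X) := by
    rw [← hXθ]; exact div_le_div_of_nonneg_right hzX hθ.le
  linarith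

/-- `(3b)^e ≤ 3 b^{1−ρ₁}` for `b ≥ 1`, `0 ≤ ρ₁`, `e ≤ 1 − ρ₁`. (ns-idea-11 g11, ported.) [folklore] -/
theorem rpow_3b_le {b e ρ₁ : ℝ} (hb : 1 ≤ b) (hρ₁ : 0 ≤ ρ₁) (he : e ≤ 1 - ρ₁) :
    (3 * b) ^ e ≤ 3 * b ^ (1 - ρ₁) := by
  have hb0 : 0 < b := by linarith
  have h3b : (1 : ℝ) ≤ 3 * b := by linarith
  calc (3 * b) ^ e ≤ (3 * b) ^ (1 - ρ₁) := Real.rpow_le_rpow_of_exponent_le h3b he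
    _ = 3 ^ (1 - ρ₁) * b ^ (1 - ρ₁) := Real.mul_rpow (by norm_num) hb0.le
    _ ≤ (3 : ℝ) ^ (1 : ℝ) * b ^ (1 - ρ₁) :=
        mul_le_mul_of_nonneg_right (Real.rpow_le_rpow_of_exponent_le (by norm_num) (by linarith))
          (Real.rpow_nonneg hb0.le _)
    _ = 3 * b ^ (1 - ρ₁) := by rw [Real.rpow_one]

set_option maxHeartbeats 400000 in
/-- The BOOKKEEPING ALGEBRA of H4c: a choice of the three AM–GM parameters making the integrated majorant
`≤ K (c+1) b^{1−ρ₁/2}/λ` with `K = 13 C √(2 + 4/ρ₁) + 13 (C+1)`. (ns-idea-11 g11, ported.) [folklore] -/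
theorem book_algebra {C ρ lam b cc : ℝ} (hC : 0 < C) (hρ : 0 < ρ) (hlam : 0 < lam) (hlam1 : lam ≤ 1)
    (hb : 1 ≤ b) (hcc : 0 ≤ cc) :
    ∃ θ₁ θ₂ θ₃ : ℝ, 0 < θ₁ ∧ 0 < θ₂ ∧ 0 < θ₃ ∧
      C / 2 * θ₁ * (cc * (3 * b) ^ (1 - ρ)) +
          (C / 2 * ((2 + 4 * Real.log b) / θ₁) + C / 2 * (θ₂ / b ^ 2) + θ₃ / (2 * b ^ 2)) *
            (16 / lam ^ 2 * (cc * (3 * b) ^ (1 - ρ))) +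
          (C / 2 * ((2 + 4 * Real.log b) / (θ₁ * b ^ 2)) + C / 2 * (cc * (3 * b) ^ (1 - 2 * ρ) / θ₂) +
              cc * (3 * b) ^ (1 - 2 * ρ) / (2 * θ₃)) * b ^ 2 ≤
        (13 * C * Real.sqrt (2 + 4 / min ρ 1) + 13 * (C + 1)) * (cc + 1) * b ^ (1 - min ρ 1 / 2) / lam := by
  have hb0 : 0 < b := by linarith
  set ρ₁ : ℝ := min ρ 1 with hρ₁
  have hρ₁0 : 0 < ρ₁ := lt_min hρ (by norm_num)
  have hρ₁ρ : ρ₁ ≤ ρ := min_le_left _ _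
  have hρ₁1 : ρ₁ ≤ 1 := min_le_right _ _
  set G : ℝ := 2 + 4 * Real.log b with hGdef
  set Dr : ℝ := cc * (3 * b) ^ (1 - ρ) with hDr
  set μr : ℝ := 16 / lam ^ 2 * Dr with hμr
  set U₀ : ℝ := cc * (3 * b) ^ (1 - 2 * ρ) with hU₀
  set Z : ℝ := b ^ (1 - ρ₁ / 2) with hZ
  set P : ℝ := b ^ (1 - ρ₁) with hP
  set Q : ℝ := b ^ ρ₁ with hQ
  have hP1 : 1 ≤ P := Real.one_le_rpow hb (by linarith)
  have hP0 : 0 < P := by linarith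
  have hQ1 : 1 ≤ Q := Real.one_le_rpow hb hρ₁0.le
  have hZ0 : 0 < Z := Real.rpow_pos_of_pos hb0 _
  have hPZ : P ≤ Z := Real.rpow_le_rpow_of_exponent_le hb (by linarith)
  -- budgets against `P`
  have h3b : (3 * b) ^ (1 - ρ) ≤ 3 * P := rpow_3b_le hb hρ₁0.le (by linarith)
  have h3b' : (3 * b) ^ (1 - 2 * ρ) ≤ 3 * P := rpow_3b_le hb hρ₁0.le (by linarith)
  have hDr0 : 0 ≤ Dr := by positivity
  have hDrW : Dr ≤ 3 * (cc + 1) * P := by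
    calc Dr ≤ cc * (3 * P) := mul_le_mul_of_nonneg_left h3b hcc
      _ ≤ 3 * (cc + 1) * P := by nlinarith
  have hμr0 : 0 ≤ μr := by positivity
  have hlam2 : lam ^ 2 ≤ 1 := by nlinarith
  have hl2 : 0 < lam ^ 2 := by positivity
  have hμrW : μr ≤ 48 * cc * P / lam ^ 2 := by
    have h1 : μr = 16 * Dr / lam ^ 2 := by rw [hμr]; ring
    rw [h1]
    exact div_le_div_of_nonneg_right (by nlinarith [mul_le_mul_of_nonneg_left h3b hcc]) hl2.le
  have hμr1 : μr + 1 ≤ 49 * (cc + 1) * P / lam ^ 2 := by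
    rw [le_div_iff₀ hl2]
    have h1 : μr * lam ^ 2 ≤ 48 * cc * P := by
      have := hμrW; rwa [le_div_iff₀ hl2] at this
    nlinarith
  have hU₀0 : 0 ≤ U₀ := by positivity
  have hU₀X : U₀ ≤ 3 * (cc + 1) * P := by
    calc U₀ ≤ cc * (3 * P) := mul_le_mul_of_nonneg_left h3b' hcc
      _ ≤ 3 * (cc + 1) * P := by nlinarith
  -- the logarithmic factor
  have hlogb : 0 ≤ Real.log b := Real.log_nonneg hb
  have hG0 : 0 ≤ G := by positivity
  have hGQ : G ≤ (2 + 4 / ρ₁) * Q := by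
    have h1 : Real.log b ≤ Q / ρ₁ := by rw [hQ]; exact Real.log_le_rpow_div hb0.le hρ₁0
    have h2 : (2 + 4 / ρ₁) * Q = 2 * Q + 4 * (Q / ρ₁) := by ring
    rw [h2, hGdef]
    nlinarith
  -- AM–GM data
  set W₁ : ℝ := 3 * (cc + 1) * P with hW₁
  set X₁ : ℝ := (2 + 4 / ρ₁) * Q * (49 * (cc + 1) * P / lam ^ 2) with hX₁
  set W₂ : ℝ := 49 * (cc + 1) * P / lam ^ 2 with hW₂
  set X₂ : ℝ := 3 * (cc + 1) * P with hX₂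
  have hg0 : 0 < 2 + 4 / ρ₁ := by positivity
  have hW₁0 : 0 < W₁ := by positivity
  have hX₁0 : 0 < X₁ := by positivity
  have hW₂0 : 0 < W₂ := by positivity
  have hX₂0 : 0 < X₂ := by positivity
  have hGX : G * (μr + 1) ≤ X₁ := by
    rw [hX₁]; exact mul_le_mul hGQ hμr1 (by positivity) (by positivity)
  have hμrW₂ : μr ≤ W₂ :=
    hμrW.trans (div_le_div_of_nonneg_right (by nlinarith) hl2.le)
  -- choose the parameters
  set φ : ℝ := Real.sqrt (X₂ / W₂) with hφ
  have hφ0 : 0 < φ := Real.sqrt_pos.2 (by positivity)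
  set θ₁ : ℝ := Real.sqrt (X₁ / W₁) with hθ₁
  have hθ₁0 : 0 < θ₁ := Real.sqrt_pos.2 (by positivity)
  refine ⟨θ₁, b ^ 2 * φ, b ^ 2 * φ, hθ₁0, by positivity, by positivity, ?_⟩
  have hθ₁ne : θ₁ ≠ 0 := hθ₁0.ne'
  have hφne : φ ≠ 0 := hφ0.ne'
  have hbne : b ≠ 0 := hb0.ne'
  -- regroup
  have hre : C / 2 * θ₁ * Dr + (C / 2 * (G / θ₁) + C / 2 * (b ^ 2 * φ / b ^ 2) + b ^ 2 * φ / (2 * b ^ 2)) * μr +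
      (C / 2 * (G / (θ₁ * b ^ 2)) + C / 2 * (U₀ / (b ^ 2 * φ)) + U₀ / (2 * (b ^ 2 * φ))) * b ^ 2 =
      C / 2 * (θ₁ * Dr + G * (μr + 1) / θ₁) + C / 2 * (φ * μr + U₀ / φ) + 1 / 2 * (φ * μr + U₀ / φ) := by
    field_simp
    ring
  have hT1 : θ₁ * Dr + G * (μr + 1) / θ₁ ≤ 2 * Real.sqrt (W₁ * X₁) := amgm_balanced hW₁0 hX₁0 hDrW hGX
  have hT2 : φ * μr + U₀ / φ ≤ 2 * Real.sqrt (W₂ * X₂) := amgm_balanced hW₂0 hX₂0 hμrW₂ hU₀X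
  -- evaluate the square roots
  have hPQP : P * Q * P = Z * Z := by
    rw [hP, hQ, hZ, ← Real.rpow_add hb0, ← Real.rpow_add hb0, ← Real.rpow_add hb0]
    congr 1
    ring
  set V : ℝ := (cc + 1) * Z / lam with hV
  have hV0 : 0 ≤ V := by positivity
  have hS1 : Real.sqrt (W₁ * X₁) ≤ 13 * Real.sqrt (2 + 4 / ρ₁) * V := by
    have h1 : W₁ * X₁ = 147 * (2 + 4 / ρ₁) * V ^ 2 := by
      calc W₁ * X₁ = 147 * (2 + 4 / ρ₁) * (cc + 1) ^ 2 / lam ^ 2 * (P * Q * P) := by rw [hW₁, hX₁]; ring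
        _ = 147 * (2 + 4 / ρ₁) * V ^ 2 := by rw [hPQP, hV]; ring
    rw [h1]
    calc Real.sqrt (147 * (2 + 4 / ρ₁) * V ^ 2)
        ≤ Real.sqrt ((13 * Real.sqrt (2 + 4 / ρ₁) * V) ^ 2) := by
          apply Real.sqrt_le_sqrt
          rw [mul_pow, mul_pow, Real.sq_sqrt hg0.le]
          exact mul_le_mul_of_nonneg_right (mul_le_mul_of_nonneg_right (by norm_num) hg0.le) (sq_nonneg V)
      _ = 13 * Real.sqrt (2 + 4 / ρ₁) * V := Real.sqrt_sq (by positivity)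
  have hS2 : Real.sqrt (W₂ * X₂) ≤ 13 * V := by
    have h1 : W₂ * X₂ = 147 * ((cc + 1) * P / lam) ^ 2 := by rw [hW₂, hX₂]; ring
    rw [h1]
    have hV' : (cc + 1) * P / lam ≤ V := by
      rw [hV]; exact div_le_div_of_nonneg_right (mul_le_mul_of_nonneg_left hPZ (by positivity)) hlam.le
    have hV'0 : 0 ≤ (cc + 1) * P / lam := by positivity
    calc Real.sqrt (147 * ((cc + 1) * P / lam) ^ 2) ≤ Real.sqrt ((13 * ((cc + 1) * P / lam)) ^ 2) := by
          apply Real.sqrt_le_sqrt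
          rw [mul_pow]
          exact mul_le_mul_of_nonneg_right (by norm_num) (sq_nonneg _)
      _ = 13 * ((cc + 1) * P / lam) := Real.sqrt_sq (by positivity)
      _ ≤ 13 * V := by linarith
  have e1 : C / 2 * (θ₁ * Dr + G * (μr + 1) / θ₁) ≤ C * (13 * Real.sqrt (2 + 4 / ρ₁) * V) := by
    calc C / 2 * (θ₁ * Dr + G * (μr + 1) / θ₁) ≤ C / 2 * (2 * Real.sqrt (W₁ * X₁)) :=
          mul_le_mul_of_nonneg_left hT1 (by positivity)
      _ ≤ C / 2 * (2 * (13 * Real.sqrt (2 + 4 / ρ₁) * V)) :=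
          mul_le_mul_of_nonneg_left (mul_le_mul_of_nonneg_left hS1 (by norm_num)) (by positivity)
      _ = C * (13 * Real.sqrt (2 + 4 / ρ₁) * V) := by ring
  have e2 : C / 2 * (φ * μr + U₀ / φ) ≤ C * (13 * V) := by
    calc C / 2 * (φ * μr + U₀ / φ) ≤ C / 2 * (2 * Real.sqrt (W₂ * X₂)) :=
          mul_le_mul_of_nonneg_left hT2 (by positivity)
      _ ≤ C / 2 * (2 * (13 * V)) := mul_le_mul_of_nonneg_left (mul_le_mul_of_nonneg_left hS2 (by norm_num)) (by positivity)
      _ = C * (13 * V) := by ring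
  have e3 : 1 / 2 * (φ * μr + U₀ / φ) ≤ 13 * V := by linarith [hT2, hS2]
  have hK : (13 * C * Real.sqrt (2 + 4 / ρ₁) + 13 * (C + 1)) * (cc + 1) * Z / lam =
      C * (13 * Real.sqrt (2 + 4 / ρ₁) * V) + C * (13 * V) + 13 * V := by rw [hV]; ring
  rw [hK]
  linarith [hre, e1, e2, e3]

end Summit.NavierStokesRegularity.NavierStokesRegularity.Theorems.PowerGaugeEulerLiouville.CasimirHaul

end
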